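import Summits.Parity.GeneralizedHardyLittlewood.Theorems.LiouvilleShiftedTablesSieveToMAvgMAvgIdent
import Literature.NumberTheory.Sieve.FriedlanderIwaniecPrimesJacobiTwistedPairBound

/-!
# Sieve glue for `SieveToMAvg`, part 11b: the `MAvg` sum through the core sums

Support file for item stmt-Parity-14274 (route `LiouvilleShiftedTables`).  With
`MAvgSum h ε x = ∑_{m ≤ x^ε} log m · |S_m(x)|` (literally the function of the node `MAvg`),
part 11a gives, for `x ≥ 1`, `h ≥ 1`, `K₀ ≥ 1`,

  `MAvgSum h ε x ≤ ε log x · K₀ · CoreSum h (K₀² ⌊x^ε⌋) (x + h) + ε log x · x log(x+h) · H_{x^ε} / K₀`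

(`k ≤ K₀` at the single height `x + h`, the map `m ↦ k²m` being injective; `k > K₀` trivially with
`∑_{k > K₀} k⁻² ≤ 1/K₀`).
-/

namespace Summit.Parity.GeneralizedHardyLittlewood.Theorems.SieveToMAvg

open Finset Real
open scoped ArithmeticFunction.zeta ArithmeticFunction.sigma ArithmeticFunction.vonMangoldt
  ArithmeticFunction.Moebius
open Literature.NumberTheory.Sieve.BFI

/-- `MAvgSum h ε x = ∑_{m ≤ x^ε} log m · |∑_{d ≤ x/m} μ(d) Λ(dm + h)|` (the function of `MAvg`). [folklore] -/
noncomputable def MAvgSum (h : ℕ) (ε x : ℝ) : ℝ :=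
  ∑ m ∈ Icc 1 ⌊x ^ ε⌋₊, Real.log m * |innerS h m x|

/-- The inner sum at dilation `m`: `|S_m(x)| ≤ ∑_{k ≤ K₀} |T(x+h; k²m, h)| + x log(x+h)/(m K₀)`
(`m, h, K₀ ≥ 1`, `x ≥ 0`). [folklore] -/
theorem abs_innerS_le {h m K₀ : ℕ} (hh : 1 ≤ h) (hm : 1 ≤ m) (hK₀ : 1 ≤ K₀) {x : ℝ} (hx : 0 ≤ x) :
    |innerS h m x| ≤ (∑ k ∈ Icc 1 K₀, |Tcorr h (k ^ 2 * m) (x + h)|) + x * Real.log (x + h) / (m * K₀) := by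
  classical
  set D := ⌊x / m⌋₊ with hD
  rw [innerS_eq_sum h m x]
  have h1 : |∑ k ∈ Icc 1 D, (μ k : ℝ) * Rq h (k ^ 2 * m) x| ≤ ∑ k ∈ Icc 1 D, |Rq h (k ^ 2 * m) x| := by
    refine (Finset.abs_sum_le_sum_abs _ _).trans (Finset.sum_le_sum fun k _ => ?_)
    rw [abs_mul]
    have : |(μ k : ℝ)| ≤ 1 := by exact_mod_cast ArithmeticFunction.abs_moebius_le_one
    exact (mul_le_mul_of_nonneg_right this (abs_nonneg _)).trans (by rw [one_mul])
  refine h1.trans ?_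
  -- split at `K₀`
  have hsplit : ∑ k ∈ Icc 1 D, |Rq h (k ^ 2 * m) x| ≤
      (∑ k ∈ Icc 1 K₀, |Rq h (k ^ 2 * m) x|) + ∑ k ∈ Ioc K₀ D, |Rq h (k ^ 2 * m) x| := by
    rw [← Finset.sum_union]
    · refine Finset.sum_le_sum_of_subset_of_nonneg (fun k hk => ?_) fun _ _ _ => abs_nonneg _
      rw [Finset.mem_Icc] at hk
      rw [Finset.mem_union, Finset.mem_Icc, Finset.mem_Ioc]
      omega
    · rw [Finset.disjoint_left]
      intro k hk hk'
      rw [Finset.mem_Icc] at hk; rw [Finset.mem_Ioc] at hk'; omega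
  refine hsplit.trans (add_le_add ?_ ?_)
  · refine Finset.sum_le_sum fun k hk => ?_
    have hk1 : 1 ≤ k := (Finset.mem_Icc.1 hk).1
    exact abs_Rq_le_abs_Tcorr (Nat.one_le_iff_ne_zero.2 (Nat.mul_ne_zero (pow_ne_zero 2 (by omega)) (by omega))) hx
  · have hm0 : (0 : ℝ) < m := by exact_mod_cast hm
    have h1h : (1 : ℝ) ≤ h := by exact_mod_cast hh
    have hlog : 0 ≤ Real.log (x + h) := Real.log_nonneg (by linarith)
    calc ∑ k ∈ Ioc K₀ D, |Rq h (k ^ 2 * m) x|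
        ≤ ∑ k ∈ Ioc K₀ D, x * Real.log (x + h) / m * ((k : ℝ) ^ 2)⁻¹ := by
          refine Finset.sum_le_sum fun k hk => ?_
          have hk1 : 1 ≤ k := by have := (Finset.mem_Ioc.1 hk).1; omega
          have hkm : 1 ≤ k ^ 2 * m := Nat.one_le_iff_ne_zero.2 (Nat.mul_ne_zero (pow_ne_zero 2 (by omega)) (by omega))
          refine (abs_Rq_le hh hkm hx).trans (le_of_eq ?_)
          push_cast
          field_simp
      _ = x * Real.log (x + h) / m * ∑ k ∈ Ioc K₀ D, ((k : ℝ) ^ 2)⁻¹ := (Finset.mul_sum _ _ _).symm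
      _ ≤ x * Real.log (x + h) / m * (K₀ : ℝ)⁻¹ :=
          mul_le_mul_of_nonneg_left (Literature.NumberTheory.Sieve.FriedlanderIwaniecPrimes.sum_Ioc_inv_sq_le hK₀ D)
            (by positivity)
      _ = x * Real.log (x + h) / (m * K₀) := by field_simp

/-- The dilation sums at the single height: for `k ≤ K₀`,
`∑_{m ≤ M} |T(X; k²m, h)| ≤ CoreSum h (K₀² M) X` (`m ↦ k²m` is injective into `[1, K₀² M]`). [folklore] -/
theorem sum_abs_Tcorr_dilations_le (h : ℕ) {k K₀ : ℕ} (hk1 : 1 ≤ k) (hk : k ≤ K₀) (M : ℕ) (X : ℝ) :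
    ∑ m ∈ Icc 1 M, |Tcorr h (k ^ 2 * m) X| ≤ CoreSum h (K₀ ^ 2 * M) X := by
  classical
  unfold CoreSum
  have hinj : Set.InjOn (fun m => k ^ 2 * m) (Icc 1 M : Set ℕ) := by
    intro a _ b _ hab
    exact Nat.eq_of_mul_eq_mul_left (by positivity) hab
  rw [← Finset.sum_image (f := fun q => |Tcorr h q X|) hinj]
  refine Finset.sum_le_sum_of_subset_of_nonneg (fun q hq => ?_) fun _ _ _ => abs_nonneg _
  obtain ⟨m, hm, rfl⟩ := Finset.mem_image.1 hq
  rw [Finset.mem_Icc] at hm ⊢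
  refine ⟨Nat.one_le_iff_ne_zero.2 (Nat.mul_ne_zero (pow_ne_zero 2 (by omega)) (by omega)), ?_⟩
  exact Nat.mul_le_mul (Nat.pow_le_pow_left hk 2) hm.2

/-- **`MAvg` through the core sums**: for `x ≥ 1`, `h ≥ 1`, `K₀ ≥ 1`, `ε ≥ 0`,
`MAvgSum h ε x ≤ ε log x · K₀ · CoreSum h (K₀²⌊x^ε⌋) (x+h) + ε log x · x log(x+h) · H_{x^ε} / K₀`. [folklore] -/
theorem MAvgSum_le {h K₀ : ℕ} (hh : 1 ≤ h) (hK₀ : 1 ≤ K₀) {ε x : ℝ} (hε : 0 ≤ ε) (hx : 1 ≤ x) :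
    MAvgSum h ε x ≤ ε * Real.log x * K₀ * CoreSum h (K₀ ^ 2 * ⌊x ^ ε⌋₊) (x + h) +
      ε * Real.log x * (x * Real.log (x + h)) * Hsum (x ^ ε) / K₀ := by
  set M := ⌊x ^ ε⌋₊ with hM
  have hx0 : 0 ≤ x := by linarith
  have hlogx : 0 ≤ Real.log x := Real.log_nonneg hx
  have h1h : (1 : ℝ) ≤ h := by exact_mod_cast hh
  have hlogxh : 0 ≤ Real.log (x + h) := Real.log_nonneg (by linarith)
  -- `log m ≤ ε log x` on the range
  have hlogm : ∀ m ∈ Icc 1 M, Real.log m ≤ ε * Real.log x ∧ 0 ≤ Real.log m := by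
    intro m hm
    obtain ⟨hm1, hmM⟩ := Finset.mem_Icc.1 hm
    have hm1' : (1 : ℝ) ≤ m := by exact_mod_cast hm1
    refine ⟨?_, Real.log_nonneg hm1'⟩
    have hmx : (m : ℝ) ≤ x ^ ε := le_trans (by exact_mod_cast hmM) (Nat.floor_le (Real.rpow_nonneg hx0 ε))
    calc Real.log m ≤ Real.log (x ^ ε) := Real.log_le_log (by linarith) hmx
      _ = ε * Real.log x := Real.log_rpow (by linarith) ε
  have hCS : 0 ≤ CoreSum h (K₀ ^ 2 * M) (x + h) := Finset.sum_nonneg fun _ _ => abs_nonneg _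
  unfold MAvgSum
  calc ∑ m ∈ Icc 1 M, Real.log m * |innerS h m x|
      ≤ ∑ m ∈ Icc 1 M, (ε * Real.log x) *
          ((∑ k ∈ Icc 1 K₀, |Tcorr h (k ^ 2 * m) (x + h)|) + x * Real.log (x + h) / (m * K₀)) := by
        refine Finset.sum_le_sum fun m hm => ?_
        have hm1 : 1 ≤ m := (Finset.mem_Icc.1 hm).1
        exact mul_le_mul (hlogm m hm).1 (abs_innerS_le hh hm1 hK₀ hx0) (abs_nonneg _) (by positivity)
    _ = (ε * Real.log x) * ((∑ m ∈ Icc 1 M, ∑ k ∈ Icc 1 K₀, |Tcorr h (k ^ 2 * m) (x + h)|) +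
          ∑ m ∈ Icc 1 M, x * Real.log (x + h) / (m * K₀)) := by
        rw [← Finset.mul_sum, Finset.sum_add_distrib]
    _ = (ε * Real.log x) * (∑ k ∈ Icc 1 K₀, ∑ m ∈ Icc 1 M, |Tcorr h (k ^ 2 * m) (x + h)|) +
          (ε * Real.log x) * (x * Real.log (x + h) / K₀ * ∑ m ∈ Icc 1 M, (m : ℝ)⁻¹) := by
        have hswap : ∑ m ∈ Icc 1 M, ∑ k ∈ Icc 1 K₀, |Tcorr h (k ^ 2 * m) (x + h)| =
            ∑ k ∈ Icc 1 K₀, ∑ m ∈ Icc 1 M, |Tcorr h (k ^ 2 * m) (x + h)| := Finset.sum_comm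
        have hB : ∑ m ∈ Icc 1 M, x * Real.log (x + h) / (m * K₀) =
            x * Real.log (x + h) / K₀ * ∑ m ∈ Icc 1 M, (m : ℝ)⁻¹ := by
          rw [Finset.mul_sum]
          refine Finset.sum_congr rfl fun m hm => ?_
          have hm0 : (m : ℝ) ≠ 0 := by have := (Finset.mem_Icc.1 hm).1; exact_mod_cast (show m ≠ 0 by omega)
          have hK : (K₀ : ℝ) ≠ 0 := by exact_mod_cast (show K₀ ≠ 0 by omega)
          field_simp
        rw [hswap, hB, mul_add]
    _ ≤ (ε * Real.log x) * (∑ _k ∈ Icc 1 K₀, CoreSum h (K₀ ^ 2 * M) (x + h)) +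
          (ε * Real.log x) * (x * Real.log (x + h) / K₀ * Hsum (x ^ ε)) := by
        refine add_le_add (mul_le_mul_of_nonneg_left (Finset.sum_le_sum fun k hk =>
          sum_abs_Tcorr_dilations_le h (Finset.mem_Icc.1 hk).1 (Finset.mem_Icc.1 hk).2 M (x + h)) (by positivity)) ?_
        exact le_of_eq rfl
    _ = _ := by
        rw [Finset.sum_const, Nat.card_Icc, Nat.add_sub_cancel, nsmul_eq_mul]
        ring

end Summit.Parity.GeneralizedHardyLittlewood.Theorems.SieveToMAvg
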